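import Literature.Dynamics.Contraction.ComplexConeContractionProofs

/-!
# Dubois 2009, Lemma 3.1 (the duality between `ℂⁿ₊ ∖ {0}` and `Int ℂⁿ₊`) — proof

Discharges the named fact `Literature.Dynamics.Contraction.Dubois2009_lemma_3_1` of
`Literature/Dynamics/Contraction/ComplexConeContraction.lean` (statement unchanged there) by
`Dubois2009_lemma_3_1_holds`, following the printed proof of

* L. Dubois, *Projective metrics and contraction principles for complex cones*, J. London Math.
  Soc. (2) 79 (2009) 719–737 = arXiv:0811.2930 [Dubois2009], Lemma 3.1, (3.16), p. 9 (read
  2026-08-15 on the held arXiv text).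

The direct halves (`x ∈ Int ℂⁿ₊`, `y ∈ ℂⁿ₊ ∖ 0` ⟹ `⟨y, x⟩ ≠ 0`; print: "up to multiplying `x`
and `y` by nonzero complex numbers … `Re⟨x, y⟩ = Σ r_k s_k cos(α_k − β_k) > 0`") are the theorem
`sum_mul_ne_zero_of_mem_rughConeInt` of `ComplexConeContractionProofs.lean` (proved there on the
way to Prop. 3.3), restated for `bilinPairing`. The converses follow the printed constructions,
without polar forms:
* if `Re(x_k conj x_l) ≤ 0` then `y = x_l e_k − x_k e_l` (or `y = e_k` when `x_k = 0`) lies in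
  `ℂⁿ₊ ∖ {0}` and `⟨y, x⟩ = 0` ("the first part is proved essentially in the same way");
* if `Re(y_k conj y_l) < 0` then, with `a = Σ_{j ≠ k,l} y_j` and `ε > 0` small enough that
  `Re((y_k + ε a) conj y_l) < 0`, the vector `x` with `x_k = 1`, `x_l = −(y_k + ε a)/y_l` and
  `x_j = ε` otherwise lies in `Int ℂⁿ₊` (its coordinates are `1`, `ε` or `x_l`, and `Re x_l > 0`)
  and `⟨y, x⟩ = y_k + y_l x_l + ε a = 0` (print: `y_k = 1`, `y_l = r s⁻¹ e^{iμ}`, `y_j = ε`).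

## References
* [Dubois2009] L. Dubois, J. London Math. Soc. (2) 79 (2009) 719–737 = arXiv:0811.2930,
  Lemma 3.1, (3.16), p. 9.
-/

noncomputable section

open scoped ComplexConjugate
open Set

namespace Literature.Dynamics.Contraction

/-- **Lemma 3.1, direct half**: `⟨y, x⟩ ≠ 0` for `y ∈ ℂⁿ₊ ∖ {0}` and `x ∈ Int ℂⁿ₊`
(`sum_mul_ne_zero_of_mem_rughConeInt`, restated for the bilinear pairing of the statement file).
[cite: Dubois2009, Lemma 3.1, (3.16)] -/
theorem bilinPairing_ne_zero {n : ℕ} {y x : Fin n → ℂ} (hy : y ∈ rughCone n) (hy0 : y ≠ 0)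
    (hx : x ∈ rughConeInt n) : bilinPairing y x ≠ 0 := by
  unfold bilinPairing
  rw [show (∑ k, y k * x k) = ∑ k, x k * y k from Finset.sum_congr rfl fun k _ => mul_comm _ _]
  exact sum_mul_ne_zero_of_mem_rughConeInt hx hy hy0

/-- **Dubois 2009, Lemma 3.1** — discharge of `Dubois2009_lemma_3_1`, following the printed proof
(p. 9): the direct halves are `bilinPairing_ne_zero` (i.e. `sum_mul_ne_zero_of_mem_rughConeInt`
of `ComplexConeContractionProofs.lean`); for the converses, if `Re(x_k conj x_l) ≤ 0`
then `y = x_l e_k − x_k e_l ∈ ℂⁿ₊ ∖ {0}` (or `y = e_k` if `x_k = 0`) pairs to zero with `x`, and if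
`Re(y_k conj y_l) < 0` then, with `a = Σ_{j ≠ k,l} y_j` and `ε > 0` small,
`x = e_k − ((y_k + ε a)/y_l) e_l + ε Σ_{j ≠ k, l} e_j ∈ Int ℂⁿ₊` pairs to zero with `y`.
[cite: Dubois2009, Lemma 3.1, (3.16)] -/
theorem Dubois2009_lemma_3_1_holds : Dubois2009_lemma_3_1 := by
  classical
  intro n
  refine ⟨fun x => ⟨fun hx y hy hy0 => bilinPairing_ne_zero hy hy0 hx, fun h => ?_⟩,
    fun y => ⟨fun hy x hx => bilinPairing_ne_zero hy.1 hy.2 hx, fun h => ⟨?_, ?_⟩⟩⟩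
  · -- first converse: `x ∈ Int ℂⁿ₊`
    by_contra hx
    simp only [rughConeInt, mem_setOf_eq, not_forall, not_lt] at hx
    obtain ⟨k, l, hkl⟩ := hx
    by_cases hk0 : x k = 0
    · refine h (Pi.single k 1) (fun i j => ?_) ?_ ?_
      · by_cases hi : i = k
        · subst hi
          by_cases hj : j = i
          · subst hj; simp
          · simp [hj]
        · simp [Pi.single_apply, hi]
      · intro h0
        have := congr_fun h0 k
        simp at this
      · simp [bilinPairing, Pi.single_apply, hk0]
    · have hkl' : k ≠ l := by
        rintro rfl
        rw [Complex.mul_conj, Complex.ofReal_re] at hkl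
        exact hk0 (Complex.normSq_eq_zero.1 (le_antisymm hkl (Complex.normSq_nonneg _)))
      -- `Re(a conj b) = Re(b conj a)`
      have hcomm : ∀ a b : ℂ, (a * conj b).re = (b * conj a).re := fun a b => by
        simp only [Complex.mul_re, Complex.conj_re, Complex.conj_im]
        ring
      set y : Fin n → ℂ := Pi.single k (x l) + Pi.single l (-x k) with hy
      have hyk : y k = x l := by simp [hy, hkl']
      have hyl : y l = -x k := by simp [hy, hkl'.symm]
      have hyj : ∀ j, j ≠ k → j ≠ l → y j = 0 := fun j hjk hjl => by
        simp [hy, hjk, hjl]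
      refine h y (fun i j => ?_) ?_ ?_
      · -- `y ∈ ℂⁿ₊`
        have hval : ∀ i, y i = 0 ∨ i = k ∨ i = l := fun i => by
          by_cases hik : i = k
          · exact Or.inr (Or.inl hik)
          by_cases hil : i = l
          · exact Or.inr (Or.inr hil)
          exact Or.inl (hyj i hik hil)
        rcases hval i with hi | rfl | rfl
        · rw [hi, zero_mul, Complex.zero_re]
        · rcases hval j with hj | rfl | rfl
          · rw [hj, map_zero, mul_zero, Complex.zero_re]
          · rw [Complex.mul_conj, Complex.ofReal_re]; exact Complex.normSq_nonneg _
          · rw [hyk, hyl, map_neg, mul_neg, Complex.neg_re, hcomm]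
            linarith
        · rcases hval j with hj | rfl | rfl
          · rw [hj, map_zero, mul_zero, Complex.zero_re]
          · rw [hyk, hyl, neg_mul, Complex.neg_re]
            linarith
          · rw [Complex.mul_conj, Complex.ofReal_re]; exact Complex.normSq_nonneg _
      · intro h0
        have := congr_fun h0 l
        rw [hyl, Pi.zero_apply, neg_eq_zero] at this
        exact hk0 this
      · -- `⟨y, x⟩ = x_l x_k − x_k x_l = 0`
        unfold bilinPairing
        rw [← Finset.add_sum_erase _ _ (Finset.mem_univ k),
          ← Finset.add_sum_erase _ _ (Finset.mem_erase.2 ⟨hkl'.symm, Finset.mem_univ l⟩),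
          Finset.sum_eq_zero, hyk, hyl]
        · ring
        · intro j hj
          simp only [Finset.mem_erase] at hj
          rw [hyj j hj.2.1 hj.1, zero_mul]
  · -- second converse, part `y ∈ ℂⁿ₊`
    by_contra hy
    simp only [rughCone, mem_setOf_eq, not_forall, not_le] at hy
    obtain ⟨k, l, hkl⟩ := hy
    have hl0 : y l ≠ 0 := by
      intro h0
      rw [h0, map_zero, mul_zero, Complex.zero_re] at hkl
      exact lt_irrefl 0 hkl
    have hkl' : k ≠ l := by
      rintro rfl
      rw [Complex.mul_conj, Complex.ofReal_re] at hkl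
      exact absurd hkl (not_lt.2 (Complex.normSq_nonneg _))
    set rest : Finset (Fin n) := (Finset.univ.erase k).erase l with hrest
    have hmem_rest : ∀ j, j ∈ rest ↔ j ≠ k ∧ j ≠ l := fun j => by
      simp [hrest, and_comm]
    set a : ℂ := ∑ j ∈ rest, y j with ha
    -- choose `ε > 0` with `Re(y_k conj y_l) + ε Re(a conj y_l) < 0`
    obtain ⟨ε, hε, hεneg⟩ : ∃ ε : ℝ, 0 < ε ∧
        (y k * conj (y l)).re + ε * (a * conj (y l)).re < 0 := by
      by_cases hA : (a * conj (y l)).re ≤ 0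
      · exact ⟨1, one_pos, by nlinarith⟩
      · push Not at hA
        refine ⟨-(y k * conj (y l)).re / (2 * (a * conj (y l)).re), ?_, ?_⟩
        · apply div_pos (by linarith) (by linarith)
        · generalize (y k * conj (y l)).re = P at hkl ⊢
          generalize (a * conj (y l)).re = R at hA ⊢
          have : -P / (2 * R) * R = -P / 2 := by
            field_simp
          rw [this]
          linarith
    set c : ℂ := -(y k + ε * a) / y l with hc
    have hcre : 0 < c.re := by
      have e : c = -((y k + ε * a) * conj (y l)) / (Complex.normSq (y l) : ℂ) := by
        rw [hc, div_eq_div_iff hl0 (by exact_mod_cast (Complex.normSq_pos.2 hl0).ne'),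
          ← Complex.mul_conj]
        ring
      rw [e, Complex.div_ofReal_re, Complex.neg_re]
      apply div_pos _ (Complex.normSq_pos.2 hl0)
      have : ((y k + ε * a) * conj (y l)).re =
          (y k * conj (y l)).re + ε * (a * conj (y l)).re := by
        rw [add_mul, Complex.add_re, mul_assoc, Complex.re_ofReal_mul]
      rw [this]
      linarith
    set x : Fin n → ℂ := fun j => if j = k then 1 else if j = l then c else (ε : ℂ) with hx
    have hxk : x k = 1 := by simp [hx]
    have hxl : x l = c := by simp [hx, hkl'.symm]
    have hxj : ∀ j, j ≠ k → j ≠ l → x j = ε := fun j hjk hjl => by simp [hx, hjk, hjl]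
    have hval : ∀ j, x j = 1 ∨ x j = c ∨ x j = ε := fun j => by
      by_cases hjk : j = k
      · exact Or.inl (by rw [hjk, hxk])
      by_cases hjl : j = l
      · exact Or.inr (Or.inl (by rw [hjl, hxl]))
      exact Or.inr (Or.inr (hxj j hjk hjl))
    have hgood : ∀ w₁ w₂ : ℂ, (w₁ = 1 ∨ w₁ = c ∨ w₁ = ε) → (w₂ = 1 ∨ w₂ = c ∨ w₂ = ε) →
        0 < (w₁ * conj w₂).re := by
      have hc2 : 0 < c.re * c.re + c.im * c.im := by nlinarith [sq_nonneg c.im]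
      rintro w₁ w₂ (rfl | rfl | rfl) (rfl | rfl | rfl) <;>
        simp [Complex.mul_re, Complex.conj_re, Complex.conj_im, hε, hcre, hc2]
    refine h x (fun i j => hgood _ _ (hval i) (hval j)) ?_
    -- `⟨y, x⟩ = y_k + y_l c + ε a = 0`
    unfold bilinPairing
    rw [← Finset.add_sum_erase _ _ (Finset.mem_univ k),
      ← Finset.add_sum_erase _ _ (Finset.mem_erase.2 ⟨hkl'.symm, Finset.mem_univ l⟩), hxk, hxl]
    have hsum : ∑ j ∈ rest, y j * x j = ε * a := by
      rw [ha, Finset.mul_sum]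
      refine Finset.sum_congr rfl fun j hj => ?_
      rw [hxj j ((hmem_rest j).1 hj).1 ((hmem_rest j).1 hj).2, mul_comm]
    rw [← hrest, hsum, hc, mul_div_cancel₀ _ hl0]
    ring
  · -- second converse, part `y ≠ 0`
    rintro rfl
    exact h (fun _ => 1) (one_mem_rughConeInt n) (by simp [bilinPairing])

end Literature.Dynamics.Contraction

end
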